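import Mathlib.Combinatorics.SimpleGraph.Girth
import Literature.Combinatorics.SimpleGraph.MooreBoundWalks
import HarnessLib

/-!
# Non-backtracking walk counts (Alon–Hoory–Linial), II: balls are trees below the girth

Support for the proof of `alonHooryLinial_mooreBound` (Theorem 1 of [AlonHooryLinial2002]),
the combinatorial half of p. 56 of the paper: "there is at most one non-returning walk of length
`≤ r` from `v` to `z` since no cycle of length `< g` exists in the graph".  Concretely:

* `cons_isPath_of_lt_egirth`, `egirth_le_of_ne_of_isPath` — girth bookkeeping (two distinct paths
  with common endpoints contain a cycle of length at most the sum of the lengths: Mathlib's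
  `SimpleGraph.Walk.IsPath.exists_isCycle_length_le_add_of_ne`);
* `exists_path_of_mem_branch`, `card_branch` — below half the girth the endpoints of distinct
  non-backtracking walks are distinct, so `|branch H k u v| = nbCount H k u v`;
* `card_ball_odd` (girth `≥ 2r+1`, ball of radius `r` around a vertex) and `card_ball_even`
  (girth `≥ 2r`, ball of depth `< r` around an edge): the vertex-count lower bounds
  `1 + Σ_{k<r} Σ_{w∼v} N_{vw,k} ≤ n` and `Σ_{k<r} (N_{uv,k} + N_{vu,k}) ≤ n`.

## References

* N. Alon, S. Hoory, N. Linial, The Moore bound for irregular graphs, *Graphs Combin.* 18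
  (2002) 53–57 [AlonHooryLinial2002].
-/

namespace Literature.Combinatorics.SimpleGraph.AlonHooryLinial

open _root_.SimpleGraph Finset

section Paths

variable {V : Type*} {H : _root_.SimpleGraph V}

/-- Prepending a step `u → v` to a path `p` from `v` that avoids the edge `uv` yields a path, unless
the graph has a cycle of length `≤ |p| + 1`. [folklore] -/
theorem cons_isPath_of_lt_egirth [DecidableEq V] {u v x : V} (h : H.Adj u v) {p : H.Walk v x}
    (hp : p.IsPath) (he : s(u, v) ∉ p.edges) (hl : ((p.length + 1 : ℕ) : ℕ∞) < H.egirth) :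
    (Walk.cons h p).IsPath := by
  rw [Walk.cons_isPath_iff]
  refine ⟨hp, fun hu => ?_⟩
  have hc : (Walk.cons h (p.takeUntil u hu)).IsCycle :=
    (Walk.cons_isCycle_iff _ h).2
      ⟨hp.takeUntil hu, fun he' => he (p.edges_takeUntil_subset_edges hu he')⟩
  have h1 := egirth_le_length hc
  have h2 := p.length_takeUntil_le_length hu
  rw [Walk.length_cons] at h1
  have h3 : (((p.takeUntil u hu).length + 1 : ℕ) : ℕ∞) ≤ ((p.length + 1 : ℕ) : ℕ∞) := by
    exact_mod_cast Nat.succ_le_succ h2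
  exact lt_irrefl _ ((h1.trans h3).trans_lt hl)

/-- Two distinct paths with the same endpoints force a cycle of length at most the sum of their
lengths (Mathlib's `IsPath.exists_isCycle_length_le_add_of_ne`), hence bound the girth.
[folklore] -/
theorem egirth_le_of_ne_of_isPath {a b : V} {p q : H.Walk a b} (hp : p.IsPath) (hq : q.IsPath)
    (hne : p ≠ q) : H.egirth ≤ ((p.length + q.length : ℕ) : ℕ∞) := by
  obtain ⟨w, -, -, c, hc, hcl⟩ := hp.exists_isCycle_length_le_add_of_ne hq hne
  exact (egirth_le_length hc).trans (by exact_mod_cast hcl)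

end Paths

section Balls

variable {V : Type*} [Fintype V] [DecidableEq V] {H : _root_.SimpleGraph V}
  [DecidableRel H.Adj]

/-- Every vertex of `branch H k u v` is the endpoint of a path `u → v → ⋯` of length `k + 1`,
provided the girth exceeds `k + 1`. [cite: AlonHooryLinial2002, §proof of Thm 1, p. 56] -/
theorem exists_path_of_mem_branch {k : ℕ} (hk : ((k + 1 : ℕ) : ℕ∞) < H.egirth) :
    ∀ {u v x : V} (huv : H.Adj u v), x ∈ branch H k u v →
      ∃ p : H.Walk v x, (Walk.cons huv p).IsPath ∧ p.length = k := by
  induction k with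
  | zero =>
    intro u v x huv hx
    rw [branch_zero, mem_singleton] at hx
    subst hx
    exact ⟨Walk.nil, by simp [huv.ne], rfl⟩
  | succ k ih =>
    intro u v x huv hx
    rw [branch_succ, mem_biUnion] at hx
    obtain ⟨w, hw, hx⟩ := hx
    rw [mem_erase, mem_neighborFinset] at hw
    have hk' : ((k + 1 : ℕ) : ℕ∞) < H.egirth :=
      lt_of_le_of_lt (by exact_mod_cast Nat.le_succ _) hk
    obtain ⟨p, hp, hpl⟩ := ih hk' hw.2 hx
    refine ⟨Walk.cons hw.2 p, cons_isPath_of_lt_egirth huv hp ?_ ?_, by simp [hpl]⟩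
    · intro hmem
      rw [Walk.edges_cons, List.mem_cons] at hmem
      rcases hmem with hmem | hmem
      · rw [Sym2.eq_iff] at hmem
        rcases hmem with ⟨huv', -⟩ | ⟨huw, -⟩
        · exact huv.ne huv'
        · exact hw.1 huw.symm
      · exact ((Walk.cons_isPath_iff _ _).1 hp).2 (p.snd_mem_support_of_mem_edges hmem)
    · rw [Walk.length_cons, hpl]
      exact hk

/-- The endpoints of distinct non-backtracking walks of length `≤ girth/2` are distinct, so
`|branch H k u v| = nbCount H k u v` when `2k <` girth.
[cite: AlonHooryLinial2002, §proof of Thm 1, p. 56] -/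
theorem card_branch {k : ℕ} (hk : ((2 * k : ℕ) : ℕ∞) < H.egirth) :
    ∀ {u v : V}, H.Adj u v → (branch H k u v).card = nbCount H k u v := by
  induction k with
  | zero => intro u v _; simp
  | succ k ih =>
    intro u v huv
    have hk1 : ((k + 1 : ℕ) : ℕ∞) < H.egirth :=
      lt_of_le_of_lt (by exact_mod_cast (by omega : k + 1 ≤ 2 * (k + 1))) hk
    have hk2 : ((2 * k : ℕ) : ℕ∞) < H.egirth :=
      lt_of_le_of_lt (by exact_mod_cast (by omega : 2 * k ≤ 2 * (k + 1))) hk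
    rw [branch_succ, nbCount_succ, card_biUnion]
    · refine sum_congr rfl fun w hw => ?_
      rw [mem_erase, mem_neighborFinset] at hw
      exact ih hk2 hw.2
    · intro w hw w' hw' hne
      rw [mem_coe, mem_erase, mem_neighborFinset] at hw hw'
      refine Finset.disjoint_left.2 fun x hx hx' => ?_
      obtain ⟨p, hp, hpl⟩ := exists_path_of_mem_branch hk1 hw.2 hx
      obtain ⟨q, hq, hql⟩ := exists_path_of_mem_branch hk1 hw'.2 hx'
      have hne' : Walk.cons hw.2 p ≠ Walk.cons hw'.2 q := by
        intro h
        have := congrArg Walk.snd h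
        rw [Walk.snd_cons, Walk.snd_cons] at this
        exact hne this
      have h1 := egirth_le_of_ne_of_isPath hp hq hne'
      rw [Walk.length_cons, Walk.length_cons, hpl, hql] at h1
      have h2 : ((k + 1 + (k + 1) : ℕ) : ℕ∞) ≤ ((2 * (k + 1) : ℕ) : ℕ∞) := by
        exact_mod_cast (by omega : k + 1 + (k + 1) ≤ 2 * (k + 1))
      exact lt_irrefl _ ((h1.trans h2).trans_lt hk)

/-- Vertices of a branch are not isolated. [folklore] -/
theorem exists_adj_of_mem_branch {k : ℕ} (hk : ((k + 1 : ℕ) : ℕ∞) < H.egirth) {u v x : V}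
    (huv : H.Adj u v) (hx : x ∈ branch H k u v) : ∃ y, H.Adj x y := by
  obtain ⟨p, hp, -⟩ := exists_path_of_mem_branch hk huv hx
  exact ⟨_, (Walk.adj_penultimate (p := Walk.cons huv p) Walk.not_nil_cons).symm⟩

/-- **Odd girth, ball around a vertex.** If the girth is at least `2r + 1`, then around any
vertex `v` the vertex itself and the endpoints of the non-backtracking walks of lengths `1, …, r`
from `v` are pairwise distinct, so a set `S` containing all non-isolated vertices has at least
`1 + Σ_{k<r} Σ_{w ∼ v} nbCount H k v w` elements.
[cite: AlonHooryLinial2002, §proof of Thm 1, p. 56] -/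
theorem card_ball_odd {r : ℕ} (hr : ((2 * r + 1 : ℕ) : ℕ∞) ≤ H.egirth) (S : Finset V)
    (hS : ∀ x y, H.Adj x y → x ∈ S) {v : V} (hv : v ∈ S) :
    1 + ∑ k ∈ range r, ∑ w ∈ H.neighborFinset v, nbCount H k v w ≤ S.card := by
  set I := (range r) ×ˢ (H.neighborFinset v) with hI
  set t : ℕ × V → Finset V := fun kw => branch H kw.1 v kw.2 with ht
  have hkr : ∀ {k}, k < r → ((k + 1 : ℕ) : ℕ∞) < H.egirth := fun {k} hk =>
    lt_of_lt_of_le (by exact_mod_cast (by omega : k + 1 < 2 * r + 1)) hr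
  have h2k : ∀ {k}, k < r → ((2 * k : ℕ) : ℕ∞) < H.egirth := fun {k} hk =>
    lt_of_lt_of_le (by exact_mod_cast (by omega : 2 * k < 2 * r + 1)) hr
  -- pairwise disjointness of the branches
  have hdisj : (I : Set (ℕ × V)).PairwiseDisjoint t := by
    rintro ⟨k, w⟩ hkw ⟨k', w'⟩ hkw' hne
    rw [mem_coe, hI, mem_product, mem_range, mem_neighborFinset] at hkw hkw'
    refine Finset.disjoint_left.2 fun x hx hx' => ?_
    obtain ⟨p, hp, hpl⟩ := exists_path_of_mem_branch (hkr hkw.1) hkw.2 hx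
    obtain ⟨q, hq, hql⟩ := exists_path_of_mem_branch (hkr hkw'.1) hkw'.2 hx'
    have hne' : Walk.cons hkw.2 p ≠ Walk.cons hkw'.2 q := by
      intro h
      apply hne
      have h1 := congrArg Walk.length h
      rw [Walk.length_cons, Walk.length_cons, hpl, hql] at h1
      have h2 := congrArg Walk.snd h
      rw [Walk.snd_cons, Walk.snd_cons] at h2
      simp only [Prod.mk.injEq]
      exact ⟨by omega, h2⟩
    have h1 := egirth_le_of_ne_of_isPath hp hq hne'
    rw [Walk.length_cons, Walk.length_cons, hpl, hql] at h1
    have h2 : ((k + 1 + (k' + 1) : ℕ) : ℕ∞) < ((2 * r + 1 : ℕ) : ℕ∞) := by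
      exact_mod_cast (by omega : k + 1 + (k' + 1) < 2 * r + 1)
    exact lt_irrefl _ ((h1.trans_lt h2).trans_le hr)
  have hvnot : v ∉ I.biUnion t := by
    intro hvmem
    rw [mem_biUnion] at hvmem
    obtain ⟨⟨k, w⟩, hkw, hvk⟩ := hvmem
    rw [hI, mem_product, mem_range, mem_neighborFinset] at hkw
    obtain ⟨p, hp, -⟩ := exists_path_of_mem_branch (hkr hkw.1) hkw.2 hvk
    exact absurd (Walk.isPath_iff_nil.1 hp) Walk.not_nil_cons
  have hsub : insert v (I.biUnion t) ⊆ S := by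
    intro x hx
    rw [mem_insert] at hx
    rcases hx with rfl | hx
    · exact hv
    · rw [mem_biUnion] at hx
      obtain ⟨⟨k, w⟩, hkw, hxk⟩ := hx
      rw [hI, mem_product, mem_range, mem_neighborFinset] at hkw
      obtain ⟨y, hy⟩ := exists_adj_of_mem_branch (hkr hkw.1) hkw.2 hxk
      exact hS x y hy
  calc 1 + ∑ k ∈ range r, ∑ w ∈ H.neighborFinset v, nbCount H k v w
      = (insert v (I.biUnion t)).card := by
        rw [card_insert_of_notMem hvnot, card_biUnion hdisj, hI, sum_product, add_comm]
        refine congrArg _ (sum_congr rfl fun k hk => sum_congr rfl fun w hw => ?_)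
        rw [mem_range] at hk
        rw [mem_neighborFinset] at hw
        exact (card_branch (h2k hk) hw).symm
    _ ≤ S.card := card_le_card hsub

/-- **Even girth, ball around an edge.** If the girth is at least `2r`, then around any edge `uv`
the endpoints of the non-backtracking walks entering through `u → v` or through `v → u` with
`< r` further steps are pairwise distinct. [cite: AlonHooryLinial2002, §proof of Thm 1, p. 56] -/
theorem card_ball_even {r : ℕ} (hr : ((2 * r : ℕ) : ℕ∞) ≤ H.egirth) (S : Finset V)
    (hS : ∀ x y, H.Adj x y → x ∈ S) {u v : V} (huv : H.Adj u v) :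
    ∑ k ∈ range r, (nbCount H k u v + nbCount H k v u) ≤ S.card := by
  have hkr : ∀ {k}, k < r → ((k + 1 : ℕ) : ℕ∞) < H.egirth := fun {k} hk =>
    lt_of_lt_of_le (by exact_mod_cast (by omega : k + 1 < 2 * r)) hr
  have h2k : ∀ {k}, k < r → ((2 * k : ℕ) : ℕ∞) < H.egirth := fun {k} hk =>
    lt_of_lt_of_le (by exact_mod_cast (by omega : 2 * k < 2 * r)) hr
  -- one side
  have hside : ∀ {a b : V} (hab : H.Adj a b),
      ((range r : Finset ℕ) : Set ℕ).PairwiseDisjoint (fun k => branch H k a b) := by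
    intro a b hab k hk k' hk' hne
    rw [mem_coe, mem_range] at hk hk'
    refine Finset.disjoint_left.2 fun x hx hx' => ?_
    obtain ⟨p, hp, hpl⟩ := exists_path_of_mem_branch (hkr hk) hab hx
    obtain ⟨q, hq, hql⟩ := exists_path_of_mem_branch (hkr hk') hab hx'
    have hne' : Walk.cons hab p ≠ Walk.cons hab q := by
      intro h
      have h1 := congrArg Walk.length h
      rw [Walk.length_cons, Walk.length_cons, hpl, hql] at h1
      exact hne (by omega)
    have h1 := egirth_le_of_ne_of_isPath hp hq hne'
    rw [Walk.length_cons, Walk.length_cons, hpl, hql] at h1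
    have h2 : ((k + 1 + (k' + 1) : ℕ) : ℕ∞) < ((2 * r : ℕ) : ℕ∞) := by
      exact_mod_cast (by omega : k + 1 + (k' + 1) < 2 * r)
    exact lt_irrefl _ ((h1.trans_lt h2).trans_le hr)
  -- across
  have hcross : Disjoint ((range r).biUnion fun k => branch H k u v)
      ((range r).biUnion fun k => branch H k v u) := by
    refine Finset.disjoint_left.2 fun x hx hx' => ?_
    rw [mem_biUnion] at hx hx'
    obtain ⟨k, hk, hx⟩ := hx
    obtain ⟨k', hk', hx'⟩ := hx'
    rw [mem_range] at hk hk'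
    obtain ⟨p, hp, hpl⟩ := exists_path_of_mem_branch (hkr hk) huv hx
    obtain ⟨q, hq, hql⟩ := exists_path_of_mem_branch (hkr hk') huv.symm hx'
    rw [Walk.cons_isPath_iff] at hq
    have hne' : Walk.cons huv p ≠ q := by
      intro h
      apply hq.2
      rw [← h, Walk.support_cons]
      exact List.mem_cons_of_mem _ p.start_mem_support
    have h1 := egirth_le_of_ne_of_isPath hp hq.1 hne'
    rw [Walk.length_cons, hpl, hql] at h1
    have h2 : ((k + 1 + k' : ℕ) : ℕ∞) < ((2 * r : ℕ) : ℕ∞) := by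
      exact_mod_cast (by omega : k + 1 + k' < 2 * r)
    exact lt_irrefl _ ((h1.trans_lt h2).trans_le hr)
  have hsub : ((range r).biUnion fun k => branch H k u v) ∪
      ((range r).biUnion fun k => branch H k v u) ⊆ S := by
    intro x hx
    rw [mem_union, mem_biUnion, mem_biUnion] at hx
    rcases hx with ⟨k, hk, hx⟩ | ⟨k, hk, hx⟩
    · rw [mem_range] at hk
      obtain ⟨y, hy⟩ := exists_adj_of_mem_branch (hkr hk) huv hx
      exact hS x y hy
    · rw [mem_range] at hk
      obtain ⟨y, hy⟩ := exists_adj_of_mem_branch (hkr hk) huv.symm hx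
      exact hS x y hy
  calc ∑ k ∈ range r, (nbCount H k u v + nbCount H k v u)
      = (((range r).biUnion fun k => branch H k u v) ∪
          ((range r).biUnion fun k => branch H k v u)).card := by
        rw [card_union_of_disjoint hcross, card_biUnion (hside huv), card_biUnion (hside huv.symm),
          sum_add_distrib]
        congr 1
        · exact sum_congr rfl fun k hk => (card_branch (h2k (mem_range.1 hk)) huv).symm
        · exact sum_congr rfl fun k hk => (card_branch (h2k (mem_range.1 hk)) huv.symm).symm
    _ ≤ S.card := card_le_card hsub

end Balls
end Literature.Combinatorics.SimpleGraph.AlonHooryLinial
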